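import Mathlib
import HarnessLib

/-!
# The V1 z-statistic's sensitivity to the τ̂ window (E-XCHECK 'straddle' class, docket L2-A17)

HONEST FRAMING: exact (Metropolis-corrected) sampling algorithms for lattice gauge theory;
figures of merit are autocorrelation/cost numbers at stated couplings and volumes; no
continuum-physics claim.

Venture `LatticeQCDFlow` (cell pub-lqcd), sub-topic `Scoring`; FANOUT row 11 (`eng-scorerA`),
row 11 GEN-14, 2026-08-21.  NEW WORK of the cell (elementary real arithmetic), not a published
result; nothing is cited as a fact.

## Content

Both frozen scorers test an oracle-covered observable with `z = |Ō − O_exact| / err`,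
`err² = 2 τ̂_int σ̂² / N` (chain mode; `Scoring/VarianceOfTheMean`), HARD iff `z > 3`.  Scorer A
takes `τ̂` from Wolff's automatic window (S = 1.5), scorer B from a Madras–Sokal `c = 6` window;
on the SAME bytes the two means and variances coincide and only `τ̂` differs, so

  `z_B = z_A · √(τ̂_A / τ̂_B)`                                          (`zStat_eq_mul_sqrt`)

(below, the statistic as a function of `τ` at fixed `|Δ|`, `σ²`, `N` is written out).  E-XCHECK
specimens 3 and 4 (lead RA-38 (15); HOME/eng-scorera/READ-EXCHECK-345-A.md, row 12's
READ-EXCHECK-B456-B.md) are exactly this: β = 4 plaquette `z_A = 2.9995` (τ̂_A 267.5) vs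
`z_B = 3.051` (τ̂_B 258.9); β = 5 `⟨Q²⟩` `z_A = 3.017` vs `z_B = 2.982` — two legitimate windows
3.3 % / 2.4 % apart in `τ̂`, hence 1.7 % / 1.2 % apart in `err`, on opposite sides of the 3σ line.
Typed here: the statistic is antitone in `τ` (`zStat_anti`); a verdict split between two windows
happens iff the threshold `c` satisfies `z(τ_large) ≤ c < z(τ_small)` (`split_iff`); the
relative move of `z` under `τ ↦ τ(1+ε)`, `ε ≥ 0`, is at most `ε/2`
(`zStat_rel_drop_le_half`) — the first-order half-width `z·δτ̂/(2τ̂)` that docket item L2-A17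
proposes to print as `z_err`; and the record instance: from A's numbers alone, B's window
predicts `z_A·√(267.5/258.9) > 3` (`s3_predicted_zB_gt_three`), i.e. the specimen-3 split is
implied by the 3.3 % window difference with no further input.  What is NOT typed: which window is
'right' (neither is; both are consistent estimators with O(δτ̂) noise), and the sampling
distribution of `z` itself.
-/

namespace Summit.Ventures.LatticeQCDFlow.Scoring

/-! The chain-mode test statistic as a function of the integrated autocorrelation time used in
the error bar is written out below as `absΔ / Real.sqrt (2 * τ * σ2 / N)` ( = `z(τ)`; no new
definition). -/

/-- **Same bytes, two windows**: `z(τ') = z(τ) · √(τ/τ')`. -/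
theorem zStat_eq_mul_sqrt {absΔ σ2 N τ τ' : ℝ} (hσ : 0 < σ2) (hN : 0 < N) (hτ : 0 < τ)
    (hτ' : 0 < τ') :
    (absΔ / Real.sqrt (2 * τ' * σ2 / N))
      = (absΔ / Real.sqrt (2 * τ * σ2 / N)) * Real.sqrt (τ / τ') := by
  have ha : 0 < 2 * σ2 / N := by positivity
  have e1 : Real.sqrt (2 * τ * σ2 / N) = Real.sqrt τ * Real.sqrt (2 * σ2 / N) := by
    rw [show 2 * τ * σ2 / N = τ * (2 * σ2 / N) by ring, Real.sqrt_mul hτ.le]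
  have e2 : Real.sqrt (2 * τ' * σ2 / N) = Real.sqrt τ' * Real.sqrt (2 * σ2 / N) := by
    rw [show 2 * τ' * σ2 / N = τ' * (2 * σ2 / N) by ring, Real.sqrt_mul hτ'.le]
  have hsτ : 0 < Real.sqrt τ := Real.sqrt_pos.mpr hτ
  have hsτ' : 0 < Real.sqrt τ' := Real.sqrt_pos.mpr hτ'
  have hsa : 0 < Real.sqrt (2 * σ2 / N) := Real.sqrt_pos.mpr ha
  rw [e1, e2, Real.sqrt_div hτ.le]
  field_simp

/-- `z` is antitone in `τ`: a LONGER window (larger `τ̂`) gives a SMALLER `z`. -/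
theorem zStat_anti {absΔ σ2 N τ τ' : ℝ} (hΔ : 0 ≤ absΔ) (hσ : 0 < σ2) (hN : 0 < N) (hτ : 0 < τ)
    (hle : τ ≤ τ') :
    (absΔ / Real.sqrt (2 * τ' * σ2 / N)) ≤ (absΔ / Real.sqrt (2 * τ * σ2 / N)) := by
  have h1 : 0 < 2 * τ * σ2 / N := by positivity
  have hle' : 2 * τ * σ2 / N ≤ 2 * τ' * σ2 / N := by
    apply div_le_div_of_nonneg_right _ hN.le
    nlinarith
  exact div_le_div_of_nonneg_left hΔ (Real.sqrt_pos.mpr h1) (Real.sqrt_le_sqrt hle')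

/-- **When do two windows split the verdict?**  With `τ ≤ τ'` (so `z(τ') ≤ z(τ)`), exactly one
of the two statistics exceeds the threshold `c` iff `z(τ') ≤ c < z(τ)`. -/
theorem split_iff {absΔ σ2 N τ τ' c : ℝ} (hΔ : 0 ≤ absΔ) (hσ : 0 < σ2) (hN : 0 < N) (hτ : 0 < τ)
    (hle : τ ≤ τ') :
    (c < (absΔ / Real.sqrt (2 * τ * σ2 / N)) ∧ ¬ c < (absΔ / Real.sqrt (2 * τ' * σ2 / N)) ∨
      ¬ c < (absΔ / Real.sqrt (2 * τ * σ2 / N)) ∧ c < (absΔ / Real.sqrt (2 * τ' * σ2 / N))) ↔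
      ((absΔ / Real.sqrt (2 * τ' * σ2 / N)) ≤ c ∧ c < (absΔ / Real.sqrt (2 * τ * σ2 / N))) := by
  have hmono := zStat_anti hΔ hσ hN hτ hle
  constructor
  · rintro (⟨h1, h2⟩ | ⟨h1, h2⟩)
    · exact ⟨not_lt.mp h2, h1⟩
    · exact absurd (lt_of_lt_of_le h2 hmono) h1
  · rintro ⟨h1, h2⟩
    exact Or.inl ⟨h2, not_lt.mpr h1⟩

/-- Elementary: `1 − 1/√(1+ε) ≤ ε/2` for `ε ≥ 0`. -/
theorem one_sub_inv_sqrt_le_half {ε : ℝ} (hε : 0 ≤ ε) :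
    1 - 1 / Real.sqrt (1 + ε) ≤ ε / 2 := by
  have hpos : 0 < 1 + ε := by linarith
  have hs : 0 < Real.sqrt (1 + ε) := Real.sqrt_pos.mpr hpos
  -- √(1+ε) ≤ 1 + ε/2
  have hle : Real.sqrt (1 + ε) ≤ 1 + ε / 2 := by
    rw [show (1 + ε) = (1 + ε) by rfl]
    apply Real.sqrt_le_iff.mpr
    constructor
    · linarith
    · nlinarith
  -- hence 1/√(1+ε) ≥ 1/(1+ε/2) ≥ 1 − ε/2
  have h1 : 1 / (1 + ε / 2) ≤ 1 / Real.sqrt (1 + ε) :=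
    one_div_le_one_div_of_le hs hle
  have h2 : 1 - ε / 2 ≤ 1 / (1 + ε / 2) := by
    rw [le_div_iff₀ (by linarith)]
    nlinarith
  linarith

/-- **First-order half-width of the statistic** (docket L2-A17's `z_err`): enlarging the window
estimate by a relative amount `ε ≥ 0`, `τ ↦ τ(1+ε)`, lowers `z` by at most the fraction `ε/2`:
`z(τ) − z(τ(1+ε)) ≤ z(τ)·ε/2`. -/
theorem zStat_rel_drop_le_half {absΔ σ2 N τ ε : ℝ} (hΔ : 0 ≤ absΔ) (hσ : 0 < σ2) (hN : 0 < N)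
    (hτ : 0 < τ) (hε : 0 ≤ ε) :
    (absΔ / Real.sqrt (2 * τ * σ2 / N)) - (absΔ / Real.sqrt (2 * (τ * (1 + ε)) * σ2 / N))
      ≤ (absΔ / Real.sqrt (2 * τ * σ2 / N)) * (ε / 2) := by
  have hτ' : 0 < τ * (1 + ε) := by positivity
  rw [zStat_eq_mul_sqrt hσ hN hτ hτ']
  have hz : 0 ≤ (absΔ / Real.sqrt (2 * τ * σ2 / N)) := by
    positivity
  have hratio : τ / (τ * (1 + ε)) = 1 / (1 + ε) := by
    field_simp
  rw [hratio, Real.sqrt_div zero_le_one, Real.sqrt_one]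
  have key := one_sub_inv_sqrt_le_half hε
  nlinarith [key, hz]

/-- **Specimen 3 from A's numbers alone** (β = 4 plaquette): `z_A = 2.9995` at `τ̂_A = 267.5`;
B's window `τ̂_B = 258.9` predicts `z = 2.9995·√(267.5/258.9) > 3` (B printed 3.051 with its
own variance estimate) — the split is implied by the 3.3 % window difference. -/
theorem s3_predicted_zB_gt_three :
    (3 : ℝ) < 2.9995 * Real.sqrt (267.5 / 258.9) := by
  have h : (3 / 2.9995 : ℝ) < Real.sqrt (267.5 / 258.9) := by
    rw [show (3 / 2.9995 : ℝ) = Real.sqrt ((3 / 2.9995) ^ 2) by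
      rw [Real.sqrt_sq (by norm_num)]]
    exact Real.sqrt_lt_sqrt (by positivity) (by norm_num)
  have h29 : (0 : ℝ) < 2.9995 := by norm_num
  calc (3 : ℝ) = 2.9995 * (3 / 2.9995) := by norm_num
    _ < 2.9995 * Real.sqrt (267.5 / 258.9) := by exact mul_lt_mul_of_pos_left h h29

/-- … and **specimen 4 the other way** (β = 5, ⟨Q²⟩): `z_A = 3.017` at A's window; a window
only 2.4 % longer (`τ' = 1.024 τ̂_A`, B's effective ratio from its printed error bar) already
gives `z ≤ 3.017/√1.024 < 3`. -/
theorem s4_longer_window_lt_three :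
    3.017 * Real.sqrt (1 / 1.024) < (3 : ℝ) := by
  have h : Real.sqrt (1 / 1.024) < (3 / 3.017 : ℝ) := by
    rw [show (3 / 3.017 : ℝ) = Real.sqrt ((3 / 3.017) ^ 2) by
      rw [Real.sqrt_sq (by norm_num)]]
    exact Real.sqrt_lt_sqrt (by positivity) (by norm_num)
  have h30 : (0 : ℝ) < 3.017 := by norm_num
  calc 3.017 * Real.sqrt (1 / 1.024) < 3.017 * (3 / 3.017) := mul_lt_mul_of_pos_left h h30
    _ = 3 := by norm_num

end Summit.Ventures.LatticeQCDFlow.Scoring
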